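import Summits.ABC.IUTFork.Repair.RHHeightScaling
import Mathlib.Analysis.SpecialFunctions.Pow.Real
import HarnessLib

/-!
# R-H ROUND 4, row R4-6 (v) «DIAG» (abc-iut-rh2-L1 g16): the `l ≍ √h` DIAGONAL REDUCES TO THE FIXED-`l` FACES —
# a UNIFORM-in-level price bound, and the transfer of `ExponentAtMost` along ANY co-moving law `l(s)`

PROOF-ONLY file (0 definitions, 0 `Prop` facts, no instance, no notation) of the abc-iut cell, rung LADDER-ABC:A2.RESCUE.H, answering the
round-4 KEY `R4OBJ-DIAG` (HOME/wake/KEY-abc-iut-rh2-L1-R4OBJ-DIAG.md; memo `plan/rescue/R-H/ROUND4/R4-6-DIAG-rh2-L1.md`): «the one height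
regime the round-3 six-class closure does not cover as typed — every AXIS-D2 face is a FIXED-`l` R78-ray face, while [IUTchIV] Cor. 2.2 CHOOSES
`l` in the window (C1) `(log q∀)^{1/2} ≤ l ≤ 10δ·(log q∀)^{1/2}·log(2δ·log q∀)`, i.e. `l` CO-MOVES with the height». STOP-LOSS of the KEY: «if the
diagonal reduces PROVABLY to a fixed-`l` face, that reduction WITH ITS LEMMA is the deliverable». This file is that lemma, over abc-iut-rh2-T-1's
shared vocabulary `Repair/RHHeightScaling.lean` (p532994) BY NAME (`price`, `demand`, `two_mul_sum_price_le_cap`, `six_mul_sum_demand_eq'`,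
`ExponentAtMost`, `NegExponent`, `DoorAt`, `not_doorAt_of_negExponent`).

WHAT IS PROVED (namespace `Summit.ABC.IUTFork.Repair.RH.HeightScalingDiagonal`).
* §1 (integers, ONE place, ANY level `l = 2L+1 ≥ 5`, ANY depth `m ≥ 0`) **`mul_sum_price_le_sum_demand`**:
  `m·(2L+1)·Σ_{j≤L} price_j(m) ≤ 5·(δ + 2(R_in − R_out) + (e − 1))·Σ_{j≤L} demand_j(m)` — the place's total price is at most `5·κ/m` times its
  total demand, `κ := (δ + 2G + e − 1)/l` the PRICE SLOPE PER UNIT OF `l`. The level enters ONLY through `κ`: this is the fixed-`l` face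
  (`two_mul_sum_price_le_cap`: `2Σprice ≤ (δ+2G+e−1)·L(L+1)`; `six_mul_sum_demand_eq'`: `6Σdemand = m·L(L−1)(2L+5)`) with its constant written as a
  function of the level, via the label factor `3(L+1)(2L+1) ≤ 5(L−1)(2L+5)` (`label_factor_le`, equality at `L = 2`, ratio `↓ 3/5`).
* §2 (reals, abstract two-parameter profiles `F : ℝ → β → ℝ` = (dilation `s`, level `b`) and ANY path `L : ℝ → β`):
  `exponentAtMost_diag_of_uniform` (one constant for every level ⇒ the same `ExponentAtMost` on every path);
  `exponentAtMost_diag_of_rpow` (level constants `≤ D·s^γ` along the path ⇒ exponent `α + γ`: **`α(diag) = α(ray) + λ`**, the law of the memo §2(e));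
  **`exponentAtMost_diag_of_log`** (level constants `≤ A + B·log s` along the path ⇒ `ExponentAtMost (α + ε) (A + B/ε)` for EVERY `ε > 0`, by
  `Real.log_le_rpow_div`); `negExponent_diag_of_log` / **`not_doorAt_diag_of_log`** (`α < 0` ⇒ the diagonal profile has a negative exponent, hence
  is NO door). In the tower dictionary of record (`e_w = e_v·l`, `δ_w = c_v·e_v·l − 1`, `R_out = min_a(p^a − a·e_w)`, `m_q` `l`-free) the slope is
  `κ(l) = κ₀ + (2e_v/ln p)·ln l` (the logarithm is the log-shell outer radius `−R_out ≍ e_w·log_p e_w`), so on `l(s) ≍ c·√(s·h)` §1 + §2 give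
  `ExponentAtMost (−1+ε)` for every `ε > 0`, `NegExponent`, `¬DoorAt` for every price-bounded tier: «exponent −1 times one logarithm» — the
  closed form `s·f(s) = A_T + (3|W_T|/h(T))·ln s` and the bed numbers (−0.961 · −0.962 · −0.959 on [10⁶,10⁹] nats, FREY133 · HEX79 · FREY482
  medians of the certified bracket, 781/781 data) are in the memo (computed ≠ proved).
* §3 `diag_place_le` (ONE place along any integer depth schedule and any level path: kept fraction `Σprice/(s·Σdemand(m)) ≤ 5·κ(s)/(m·s)` at every
  real `s ≥ 1`, `κ(s)` := the slope at the path's level) and `exponentAtMost_diag_place_of_log` (slope `≤ κ₀ + κ₁·log s` ⇒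
  `ExponentAtMost (−1+ε) (5κ₀/m + 5κ₁/(m·ε))`); §4 bed rows by `decide` at the worked place HEX `λ₄`, `p = 7` (`e_v = 15`, `m = n_v/2 = 60`):
  level `l = 19` (tabulated, `L = 9`) and the diagonal's next point `l = 41` (`s = 4`, `L = 20`, `m = 240`): `m·l·Σprice ≤ 5KΣdemand` with room, and
  the slope drift `K/l = 1706/19 < 4438/41` (89.8 → 108.2: the logarithm, in integers).
HONEST FRAMING: integer/real bookkeeping about OUR typed cell currency; nothing here decides any cell at genuine data, asserts or denies
[IUTchIII] Cor. 3.12 / [IUTchIV] Thm. 1.10 / Cor. 2.2, or bears on abc; no side taken on any author; typed ≠ proved; computed ≠ proved.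
[claim: Mochizuki2012, status: disputed] for every IUT locution. [cite: Mochizuki2012, IUTchIV Cor. 2.2 (C1) p. 42, proof (P1)–(P3) p. 45, display p. 46;
Prop. 1.2 (i)(ii) p. 10] [cite: DupuyHilado2025, §4.12]
-/

noncomputable section

open Finset

namespace Summit.ABC.IUTFork.Repair.RH.HeightScalingDiagonal

open Summit.ABC.IUTFork.Repair.RH.HeightScaling

/-! ## §1. One place, any level: the total price is at most `5·(slope)/m` times the total demand -/

/-- The label factor: `3(L+1)(2L+1) ≤ 5(L−1)(2L+5)` for `L ≥ 2` (difference `2(2L+7)(L−2) ≥ 0`; equality at `L = 2`). [folklore] -/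
theorem label_factor_le {L : ℤ} (hL : 2 ≤ L) : 3 * ((L + 1) * (2 * L + 1)) ≤ 5 * ((L - 1) * (2 * L + 5)) := by
  nlinarith

/-- **UNIFORM-IN-LEVEL PRICE BOUND (the fixed-`l` face with its constant as a function of `l`).** At a place with `0 < e`, `0 ≤ δ`,
`R_out ≤ R_in`, ANY depth `m ≥ 0` and ANY level `l = 2L+1` with `L ≥ 2`:
`m·(2L+1)·Σ_{j=1}^{L} price_j ≤ 5·(δ + 2(R_in − R_out) + (e − 1))·Σ_{j=1}^{L} demand_j(m)`. [folklore] -/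
theorem mul_sum_price_le_sum_demand {e m δ rin rout : ℤ} (he : 0 < e) (hδ : 0 ≤ δ) (hio : rout ≤ rin) (hm : 0 ≤ m)
    {L : ℕ} (hL : 2 ≤ L) :
    m * (2 * (L : ℤ) + 1) * ∑ k ∈ range L, price e m (1 + (k : ℤ)) δ rin rout ≤
      5 * (δ + 2 * (rin - rout) + (e - 1)) * ∑ k ∈ range L, demand m (1 + (k : ℤ)) := by
  set P := ∑ k ∈ range L, price e m (1 + (k : ℤ)) δ rin rout with hPdef
  set Dm := ∑ k ∈ range L, demand m (1 + (k : ℤ)) with hDdef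
  set K := δ + 2 * (rin - rout) + (e - 1) with hKdef
  have hP : 2 * P ≤ K * ((L : ℤ) * (L + 1)) := two_mul_sum_price_le_cap (m := m) (δ := δ) he hio L
  have hD : 6 * Dm = m * ((L : ℤ) * (L - 1) * (2 * L + 5)) := six_mul_sum_demand_eq' m L
  have hL' : (2 : ℤ) ≤ (L : ℤ) := by exact_mod_cast hL
  have hLf := label_factor_le hL'
  have hK : 0 ≤ K := by rw [hKdef]; linarith
  have h3m : 0 ≤ 3 * m * (2 * (L : ℤ) + 1) := by positivity
  have hKmL : 0 ≤ K * m * (L : ℤ) := by positivity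
  have h6 : 6 * (m * (2 * (L : ℤ) + 1) * P) ≤ 6 * (5 * K * Dm) :=
    calc 6 * (m * (2 * (L : ℤ) + 1) * P) = 3 * m * (2 * (L : ℤ) + 1) * (2 * P) := by ring
      _ ≤ 3 * m * (2 * (L : ℤ) + 1) * (K * ((L : ℤ) * (L + 1))) := mul_le_mul_of_nonneg_left hP h3m
      _ = K * m * (L : ℤ) * (3 * (((L : ℤ) + 1) * (2 * L + 1))) := by ring
      _ ≤ K * m * (L : ℤ) * (5 * (((L : ℤ) - 1) * (2 * L + 5))) := mul_le_mul_of_nonneg_left hLf hKmL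
      _ = 5 * K * (m * ((L : ℤ) * (L - 1) * (2 * L + 5))) := by ring
      _ = 5 * K * (6 * Dm) := by rw [hD]
      _ = 6 * (5 * K * Dm) := by ring
  linarith

/-- Real form of §1: `Σprice ≤ (5·K/((2L+1)·m))·Σdemand(m)` for `m > 0` — the place keeps at most `5κ/m` of its demand at EVERY level,
`κ = K/l`. [folklore] -/
theorem sum_price_le_slope_mul_sum_demand {e m δ rin rout : ℤ} (he : 0 < e) (hδ : 0 ≤ δ) (hio : rout ≤ rin) (hm : 0 < m)
    {L : ℕ} (hL : 2 ≤ L) :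
    ((∑ k ∈ range L, price e m (1 + (k : ℤ)) δ rin rout : ℤ) : ℝ) ≤
      5 * ((δ + 2 * (rin - rout) + (e - 1) : ℤ) : ℝ) / ((2 * (L : ℝ) + 1) * (m : ℝ)) *
        ((∑ k ∈ range L, demand m (1 + (k : ℤ)) : ℤ) : ℝ) := by
  have h := mul_sum_price_le_sum_demand he hδ hio hm.le hL
  have hcast : ((m : ℤ) : ℝ) * (2 * (L : ℝ) + 1) * ((∑ k ∈ range L, price e m (1 + (k : ℤ)) δ rin rout : ℤ) : ℝ) ≤
      5 * ((δ + 2 * (rin - rout) + (e - 1) : ℤ) : ℝ) * ((∑ k ∈ range L, demand m (1 + (k : ℤ)) : ℤ) : ℝ) := by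
    exact_mod_cast h
  have hpos : 0 < (2 * (L : ℝ) + 1) * (m : ℝ) := by positivity
  rw [div_mul_eq_mul_div, le_div_iff₀ hpos]
  calc ((∑ k ∈ range L, price e m (1 + (k : ℤ)) δ rin rout : ℤ) : ℝ) * ((2 * (L : ℝ) + 1) * (m : ℝ))
        = ((m : ℤ) : ℝ) * (2 * (L : ℝ) + 1) * ((∑ k ∈ range L, price e m (1 + (k : ℤ)) δ rin rout : ℤ) : ℝ) := by push_cast; ring
    _ ≤ 5 * ((δ + 2 * (rin - rout) + (e - 1) : ℤ) : ℝ) * ((∑ k ∈ range L, demand m (1 + (k : ℤ)) : ℤ) : ℝ) := hcast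

/-! ## §2. Two-parameter profiles: `ExponentAtMost` transfers from the fixed-level faces to EVERY co-moving path -/

section Transfer

variable {β : Type*}

/-- **ONE constant for every level ⇒ the same exponent on every path.** If `ExponentAtMost (F · b) α C` for EVERY level `b`, then the
diagonal profile `s ↦ F s (L s)` has `ExponentAtMost α C` for EVERY law `L : ℝ → β`. [folklore] -/
theorem exponentAtMost_diag_of_uniform {F : ℝ → β → ℝ} {α C : ℝ} (h : ∀ b : β, ExponentAtMost (fun s => F s b) α C)
    (L : ℝ → β) : ExponentAtMost (fun s => F s (L s)) α C :=
  fun s hs => h (L s) s hs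

/-- **THE LAW `α(diag) = α(ray) + λ`.** If every level `b` has `ExponentAtMost (F · b) α (C b)` and along the path the level constant grows at
most like `D·s^γ` (`C (L s) ≤ D·s^γ` for `s ≥ 1`), then the diagonal profile has `ExponentAtMost (α + γ) D`. [folklore] -/
theorem exponentAtMost_diag_of_rpow {F : ℝ → β → ℝ} {α : ℝ} {C : β → ℝ} (h : ∀ b : β, ExponentAtMost (fun s => F s b) α (C b))
    (L : ℝ → β) {D γ : ℝ} (hD : ∀ s : ℝ, 1 ≤ s → C (L s) ≤ D * s ^ γ) :
    ExponentAtMost (fun s => F s (L s)) (α + γ) D := by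
  intro s hs
  have hs0 : 0 < s := by linarith
  have h1 : F s (L s) ≤ C (L s) * s ^ α := h (L s) s hs
  calc F s (L s) ≤ C (L s) * s ^ α := h1
    _ ≤ D * s ^ γ * s ^ α := mul_le_mul_of_nonneg_right (hD s hs) (Real.rpow_nonneg hs0.le α)
    _ = D * s ^ (α + γ) := by rw [Real.rpow_add hs0, mul_assoc, mul_comm (s ^ γ)]

/-- **LOG-GROWING LEVEL CONSTANTS COST EXACTLY `ε`.** If every level `b` has `ExponentAtMost (F · b) α (C b)` and along the path
`C (L s) ≤ A + B·log s` (`A, B ≥ 0`, `s ≥ 1`), then for EVERY `ε > 0` the diagonal profile has `ExponentAtMost (α + ε) (A + B/ε)`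
(`log s ≤ s^ε/ε`, `Real.log_le_rpow_div`). [folklore] -/
theorem exponentAtMost_diag_of_log {F : ℝ → β → ℝ} {α : ℝ} {C : β → ℝ} (h : ∀ b : β, ExponentAtMost (fun s => F s b) α (C b))
    (L : ℝ → β) {A B : ℝ} (hA : 0 ≤ A) (hB : 0 ≤ B) (hC : ∀ s : ℝ, 1 ≤ s → C (L s) ≤ A + B * Real.log s)
    {ε : ℝ} (hε : 0 < ε) :
    ExponentAtMost (fun s => F s (L s)) (α + ε) (A + B / ε) := by
  refine exponentAtMost_diag_of_rpow h L fun s hs => ?_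
  have hs0 : 0 ≤ s := by linarith
  have hlog : Real.log s ≤ s ^ ε / ε := Real.log_le_rpow_div hs0 hε
  have hone : 1 ≤ s ^ ε := Real.one_le_rpow hs hε.le
  have hsε : 0 ≤ s ^ ε := by linarith
  calc C (L s) ≤ A + B * Real.log s := hC s hs
    _ ≤ A * s ^ ε + B * (s ^ ε / ε) := by nlinarith [mul_le_mul_of_nonneg_left hlog hB]
    _ = (A + B / ε) * s ^ ε := by ring

/-- **A negative fixed-level exponent survives log-growing constants.** Under the hypotheses of `exponentAtMost_diag_of_log` with `α < 0`
the diagonal profile has `NegExponent` (take `ε = −α/2`). [folklore] -/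
theorem negExponent_diag_of_log {F : ℝ → β → ℝ} {α : ℝ} {C : β → ℝ} (h : ∀ b : β, ExponentAtMost (fun s => F s b) α (C b))
    (L : ℝ → β) {A B : ℝ} (hA : 0 ≤ A) (hB : 0 ≤ B) (hC : ∀ s : ℝ, 1 ≤ s → C (L s) ≤ A + B * Real.log s) (hα : α < 0) :
    NegExponent (fun s => F s (L s)) := by
  have hε : 0 < -α / 2 := by linarith
  refine ⟨α + -α / 2, A + B / (-α / 2), by linarith, ?_, exponentAtMost_diag_of_log h L hA hB hC hε⟩
  exact add_nonneg hA (div_nonneg hB hε.le)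

/-- **NO DOOR ON THE DIAGONAL** (under the same hypotheses): `¬ DoorAt (s ↦ F s (L s))` — `not_doorAt_of_negExponent` BY NAME. [folklore] -/
theorem not_doorAt_diag_of_log {F : ℝ → β → ℝ} {α : ℝ} {C : β → ℝ} (h : ∀ b : β, ExponentAtMost (fun s => F s b) α (C b))
    (L : ℝ → β) {A B : ℝ} (hA : 0 ≤ A) (hB : 0 ≤ B) (hC : ∀ s : ℝ, 1 ≤ s → C (L s) ≤ A + B * Real.log s) (hα : α < 0) :
    ¬ DoorAt (fun s => F s (L s)) :=
  not_doorAt_of_negExponent (negExponent_diag_of_log h L hA hB hC hα)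

/-- **A POLYNOMIALLY growing level constant is what a diagonal door needs**: if `C (L s) ≤ D·s^γ` with `α + γ < 0` and `D ≥ 0` there is
still no door; contrapositively a door on the path forces `γ ≥ −α` for every admissible `(D, γ)` — for the price-bounded tiers (`α = −1`)
a fixed-level constant growing at least like `s`, i.e. like `l²` on `l ≍ √s`. [folklore] -/
theorem not_doorAt_diag_of_rpow {F : ℝ → β → ℝ} {α : ℝ} {C : β → ℝ} (h : ∀ b : β, ExponentAtMost (fun s => F s b) α (C b))
    (L : ℝ → β) {D γ : ℝ} (hD0 : 0 ≤ D) (hD : ∀ s : ℝ, 1 ≤ s → C (L s) ≤ D * s ^ γ) (hαγ : α + γ < 0) :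
    ¬ DoorAt (fun s => F s (L s)) :=
  not_doorAt_of_negExponent ⟨α + γ, D, hαγ, hD0, exponentAtMost_diag_of_rpow h L hD⟩

end Transfer

/-! ## §3. One place along the diagonal: kept fraction `≤ 5·κ(s)/(m·s)`, hence `ExponentAtMost (−1+ε)` under a log-growing slope -/

section Place

variable (eL δL rinL routL : ℕ → ℤ) (m : ℤ) (Lv : ℝ → ℕ) (dep : ℝ → ℤ)

/-- **THE PLACE'S DIAGONAL PROFILE IS `≤ 5·κ(s)/(m·s)` AT EVERY REAL `s ≥ 1`.** Level-indexed integers `e_L, δ_L, R_in,L, R_out,L`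
(`0 < e_L`, `0 ≤ δ_L`, `R_out,L ≤ R_in,L` at every level), an `l`-free unit depth `m > 0`, ANY level path `Lv : ℝ → ℕ` with `Lv s ≥ 2` and ANY
integer depth schedule `dep s` for the prices (the cap is depth-free, so no sign or size condition on `dep` is needed): the kept fraction «total price at level `Lv s` over the dilated
total demand `s·Σdemand(m)`» is at most `5·K(Lv s)/((2·Lv s + 1)·m) · s⁻¹`. [folklore] -/
theorem diag_place_le (he : ∀ L, 0 < eL L) (hδ : ∀ L, 0 ≤ δL L) (hio : ∀ L, routL L ≤ rinL L) (hm : 0 < m)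
    (hLv : ∀ s : ℝ, 1 ≤ s → 2 ≤ Lv s) (f : ℝ → ℝ)
    (hf : ∀ s : ℝ, 1 ≤ s → f s =
      ((∑ k ∈ range (Lv s), price (eL (Lv s)) (dep s) (1 + (k : ℤ)) (δL (Lv s)) (rinL (Lv s)) (routL (Lv s)) : ℤ) : ℝ) /
        (s * ((∑ k ∈ range (Lv s), demand m (1 + (k : ℤ)) : ℤ) : ℝ)))
    {s : ℝ} (hs : 1 ≤ s) :
    f s ≤ 5 * ((δL (Lv s) + 2 * (rinL (Lv s) - routL (Lv s)) + (eL (Lv s) - 1) : ℤ) : ℝ) / ((2 * (Lv s : ℝ) + 1) * (m : ℝ)) * s⁻¹ := by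
  rw [hf s hs]
  set L := Lv s with hLdef
  have hL : 2 ≤ L := hLv s hs
  have hs0 : 0 < s := by linarith
  -- the cap at the schedule's depth, and the demand identity at the unit depth `m` and at the depth `dep s`
  have hP : 2 * ∑ k ∈ range L, price (eL L) (dep s) (1 + (k : ℤ)) (δL L) (rinL L) (routL L) ≤
      (δL L + 2 * (rinL L - routL L) + (eL L - 1)) * ((L : ℤ) * (L + 1)) :=
    two_mul_sum_price_le_cap (m := dep s) (δ := δL L) (he L) (hio L) L
  have hD : 6 * ∑ k ∈ range L, demand m (1 + (k : ℤ)) = m * ((L : ℤ) * (L - 1) * (2 * L + 5)) := six_mul_sum_demand_eq' m L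
  have hL' : (2 : ℤ) ≤ (L : ℤ) := by exact_mod_cast hL
  have hLf := label_factor_le hL'
  have hK : 0 ≤ δL L + 2 * (rinL L - routL L) + (eL L - 1) := by linarith [he L, hδ L, hio L]
  -- integer chain: m(2L+1)·ΣP ≤ 5K·ΣD(m)
  have hint : m * (2 * (L : ℤ) + 1) * ∑ k ∈ range L, price (eL L) (dep s) (1 + (k : ℤ)) (δL L) (rinL L) (routL L) ≤
      5 * (δL L + 2 * (rinL L - routL L) + (eL L - 1)) * ∑ k ∈ range L, demand m (1 + (k : ℤ)) := by
    have h3m : 0 ≤ 3 * m * (2 * (L : ℤ) + 1) := by positivity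
    have hKmL : 0 ≤ (δL L + 2 * (rinL L - routL L) + (eL L - 1)) * m * (L : ℤ) := by positivity
    have h6 : 6 * (m * (2 * (L : ℤ) + 1) * ∑ k ∈ range L, price (eL L) (dep s) (1 + (k : ℤ)) (δL L) (rinL L) (routL L)) ≤
        6 * (5 * (δL L + 2 * (rinL L - routL L) + (eL L - 1)) * ∑ k ∈ range L, demand m (1 + (k : ℤ))) :=
      calc 6 * (m * (2 * (L : ℤ) + 1) * ∑ k ∈ range L, price (eL L) (dep s) (1 + (k : ℤ)) (δL L) (rinL L) (routL L))
            = 3 * m * (2 * (L : ℤ) + 1) * (2 * ∑ k ∈ range L, price (eL L) (dep s) (1 + (k : ℤ)) (δL L) (rinL L) (routL L)) := by ring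
        _ ≤ 3 * m * (2 * (L : ℤ) + 1) * ((δL L + 2 * (rinL L - routL L) + (eL L - 1)) * ((L : ℤ) * (L + 1))) :=
            mul_le_mul_of_nonneg_left hP h3m
        _ = (δL L + 2 * (rinL L - routL L) + (eL L - 1)) * m * (L : ℤ) * (3 * (((L : ℤ) + 1) * (2 * L + 1))) := by ring
        _ ≤ (δL L + 2 * (rinL L - routL L) + (eL L - 1)) * m * (L : ℤ) * (5 * (((L : ℤ) - 1) * (2 * L + 5))) :=
            mul_le_mul_of_nonneg_left hLf hKmL
        _ = 5 * (δL L + 2 * (rinL L - routL L) + (eL L - 1)) * (m * ((L : ℤ) * (L - 1) * (2 * L + 5))) := by ring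
        _ = 5 * (δL L + 2 * (rinL L - routL L) + (eL L - 1)) * (6 * ∑ k ∈ range L, demand m (1 + (k : ℤ))) := by rw [hD]
        _ = 6 * (5 * (δL L + 2 * (rinL L - routL L) + (eL L - 1)) * ∑ k ∈ range L, demand m (1 + (k : ℤ))) := by ring
    linarith
  -- the demand total is positive at L ≥ 2, m > 0
  have hDpos : 0 < ∑ k ∈ range L, demand m (1 + (k : ℤ)) := by
    have h1 : (0 : ℤ) < (L : ℤ) * (L - 1) * (2 * L + 5) := by
      have : (1 : ℤ) ≤ (L : ℤ) - 1 := by linarith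
      positivity
    nlinarith
  have hcast : ((m : ℤ) : ℝ) * (2 * (L : ℝ) + 1) *
      ((∑ k ∈ range L, price (eL L) (dep s) (1 + (k : ℤ)) (δL L) (rinL L) (routL L) : ℤ) : ℝ) ≤
      5 * ((δL L + 2 * (rinL L - routL L) + (eL L - 1) : ℤ) : ℝ) * ((∑ k ∈ range L, demand m (1 + (k : ℤ)) : ℤ) : ℝ) := by
    exact_mod_cast hint
  have hDposR : (0 : ℝ) < ((∑ k ∈ range L, demand m (1 + (k : ℤ)) : ℤ) : ℝ) := by exact_mod_cast hDpos
  have hmR : (0 : ℝ) < (m : ℝ) := by exact_mod_cast hm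
  have hden : 0 < s * ((∑ k ∈ range L, demand m (1 + (k : ℤ)) : ℤ) : ℝ) := mul_pos hs0 hDposR
  rw [div_le_iff₀ hden]
  have h2L : 0 < (2 * (L : ℝ) + 1) * (m : ℝ) := by positivity
  rw [show 5 * ((δL L + 2 * (rinL L - routL L) + (eL L - 1) : ℤ) : ℝ) / ((2 * (L : ℝ) + 1) * (m : ℝ)) * s⁻¹ *
      (s * ((∑ k ∈ range L, demand m (1 + (k : ℤ)) : ℤ) : ℝ)) =
      5 * ((δL L + 2 * (rinL L - routL L) + (eL L - 1) : ℤ) : ℝ) * ((∑ k ∈ range L, demand m (1 + (k : ℤ)) : ℤ) : ℝ) /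
      ((2 * (L : ℝ) + 1) * (m : ℝ)) by field_simp]
  rw [le_div_iff₀ h2L]
  calc ((∑ k ∈ range L, price (eL L) (dep s) (1 + (k : ℤ)) (δL L) (rinL L) (routL L) : ℤ) : ℝ) * ((2 * (L : ℝ) + 1) * (m : ℝ))
        = ((m : ℤ) : ℝ) * (2 * (L : ℝ) + 1) *
          ((∑ k ∈ range L, price (eL L) (dep s) (1 + (k : ℤ)) (δL L) (rinL L) (routL L) : ℤ) : ℝ) := by push_cast; ring
    _ ≤ 5 * ((δL L + 2 * (rinL L - routL L) + (eL L - 1) : ℤ) : ℝ) * ((∑ k ∈ range L, demand m (1 + (k : ℤ)) : ℤ) : ℝ) := hcast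

/-- **`ExponentAtMost (−1+ε)` FOR THE PLACE'S DIAGONAL PROFILE** under a log-growing slope: if along the path
`5·K(Lv s)/((2·Lv s + 1)·m) ≤ κ₀ + κ₁·log s` (`κ₀, κ₁ ≥ 0`; the tower dictionary gives `κ₁ = 5e_v/(m·ln p)·(1/2)·2` per the memo), then for every
`ε > 0`: `ExponentAtMost f (−1+ε) (κ₀ + κ₁/ε)` — «exponent −1 times one logarithm». [folklore] -/
theorem exponentAtMost_diag_place_of_log (he : ∀ L, 0 < eL L) (hδ : ∀ L, 0 ≤ δL L) (hio : ∀ L, routL L ≤ rinL L) (hm : 0 < m)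
    (hLv : ∀ s : ℝ, 1 ≤ s → 2 ≤ Lv s) (f : ℝ → ℝ)
    (hf : ∀ s : ℝ, 1 ≤ s → f s =
      ((∑ k ∈ range (Lv s), price (eL (Lv s)) (dep s) (1 + (k : ℤ)) (δL (Lv s)) (rinL (Lv s)) (routL (Lv s)) : ℤ) : ℝ) /
        (s * ((∑ k ∈ range (Lv s), demand m (1 + (k : ℤ)) : ℤ) : ℝ)))
    {κ₀ κ₁ : ℝ} (hκ₀ : 0 ≤ κ₀) (hκ₁ : 0 ≤ κ₁)
    (hκ : ∀ s : ℝ, 1 ≤ s →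
      5 * ((δL (Lv s) + 2 * (rinL (Lv s) - routL (Lv s)) + (eL (Lv s) - 1) : ℤ) : ℝ) / ((2 * (Lv s : ℝ) + 1) * (m : ℝ)) ≤
        κ₀ + κ₁ * Real.log s)
    {ε : ℝ} (hε : 0 < ε) :
    ExponentAtMost f (-1 + ε) (κ₀ + κ₁ / ε) := by
  -- view `f` as the path of the two-parameter profile `F s b := f s` with level constant `C b := 5K(b)/((2b+1)m)` and exponent −1
  have hface : ∀ b : ℕ, ExponentAtMost (fun s => if Lv s = b then f s else 0)
      (-1) (max (5 * ((δL b + 2 * (rinL b - routL b) + (eL b - 1) : ℤ) : ℝ) / ((2 * (b : ℝ) + 1) * (m : ℝ))) 0) := by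
    intro b s hs
    have hs0 : 0 < s := by linarith
    by_cases hb : Lv s = b
    · simp only [hb, if_true]
      have h := diag_place_le eL δL rinL routL m Lv dep he hδ hio hm hLv f hf hs
      rw [hb] at h
      calc f s ≤ 5 * ((δL b + 2 * (rinL b - routL b) + (eL b - 1) : ℤ) : ℝ) / ((2 * (b : ℝ) + 1) * (m : ℝ)) * s⁻¹ := h
        _ ≤ max (5 * ((δL b + 2 * (rinL b - routL b) + (eL b - 1) : ℤ) : ℝ) / ((2 * (b : ℝ) + 1) * (m : ℝ))) 0 * s ^ (-1 : ℝ) := by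
            rw [Real.rpow_neg_one]
            exact mul_le_mul_of_nonneg_right (le_max_left _ _) (inv_nonneg.mpr hs0.le)
    · simp only [hb, if_false]
      exact mul_nonneg (le_max_right _ _) (Real.rpow_nonneg hs0.le _)
  have hpath := exponentAtMost_diag_of_log (F := fun s b => if Lv s = b then f s else 0) hface Lv hκ₀ hκ₁ (fun s hs => ?_) hε
  · intro s hs
    have := hpath s hs
    simpa using this
  · -- the level constant along the path is below κ₀ + κ₁ log s (the `max … 0` is harmless: κ₀ + κ₁ log s ≥ 0 at s ≥ 1)
    have hlog : 0 ≤ Real.log s := Real.log_nonneg hs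
    refine max_le (hκ s hs) ?_
    positivity

end Place

/-! ## §4. Bed rows at the worked place HEX `λ₄`, `p = 7` (`e_v = 15`, `n_v = 120`): the tabulated level `l = 19` and the diagonal's
next point `l = 41` (`s = 4`: `m = 240`, `e = 615`, `δ = 614`, `R_in = 103`, `R_out = −1502`) — integers of `R4-6-DIAG-exact-sample-v411-rh2-L1.tsv` -/

/-- `l = 19` (`L = 9`, `e = 285`, `δ = 284`, `R_in = 48`, `R_out = −521`, `m = 60`): `Σprice = 44949`, `Σdemand = 16560`, `K = 1706`;
`m·l·Σprice = 51241860 ≤ 5KΣdemand = 141256800`. [folklore] -/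
theorem row_hex4_p7_l19 :
    (∑ k ∈ range 9, price 285 60 (1 + (k : ℤ)) 284 48 (-521) = 44949) ∧
    (∑ k ∈ range 9, demand 60 (1 + (k : ℤ)) = 16560) ∧
    (60 * 19 * (44949 : ℤ) ≤ 5 * (284 + 2 * (48 - (-521)) + (285 - 1)) * 16560) := by
  refine ⟨?_, ?_, ?_⟩
  · decide
  · decide
  · norm_num

/-- `l = 41`, `s = 4` (`L = 20`, `e = 615`, `δ = 614`, `R_in = 103`, `R_out = −1502`, `m = 240`): `Σprice = 504130`, `Σdemand = 684000`,
`K = 4438`; `m·l·Σprice ≤ 5KΣdemand`, and the SLOPE DRIFT `K·19 < K′·… `: `1706·41 < 4438·19` (κ = K/l: 89.8 → 108.2, the logarithm of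
§2 read in integers). [folklore] -/
theorem row_hex4_p7_l41 :
    (∑ k ∈ range 20, price 615 240 (1 + (k : ℤ)) 614 103 (-1502) = 504130) ∧
    (∑ k ∈ range 20, demand 240 (1 + (k : ℤ)) = 684000) ∧
    (240 * 41 * (504130 : ℤ) ≤ 5 * (614 + 2 * (103 - (-1502)) + (615 - 1)) * 684000) ∧
    ((1706 : ℤ) * 41 < 4438 * 19) := by
  refine ⟨?_, ?_, ?_, ?_⟩
  · decide
  · decide
  · norm_num
  · norm_num

end Summit.ABC.IUTFork.Repair.RH.HeightScalingDiagonal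

end
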